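import Literature.AlgebraicGeometry.Resolution.NodeLocalStructureAlgebra
import Literature.AlgebraicGeometry.Resolution.NodeFittingIdeal
import Literature.AlgebraicGeometry.Resolution.AdicNoetherian
import Mathlib.RingTheory.Flat.FaithfullyFlat.Algebra
import Mathlib.Tactic.Module
import HarnessLib

/-!
# De Jong 1996, 2.23, Remark: the trace of `Sing(f)` on `A⟦u, v⟧/(uv - h)` is `(u, v)`

Topic: `Literature/AlgebraicGeometry/Resolution`. Pure commutative algebra behind the Remark
of de Jong 1996, 2.23:

> "We remark that in this case (i.e. `h ∈ A'`) the trace of `Sing(f)` on the scheme `Spec B`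
> is given by the ideal `(u, v) ⊂ B`." (p. 62)

Here `B ≅ A'⟦u, v⟧/(uv - h)` is the complete local ring of the semi-stable curve `f : X → S`
at a point `x` of `Sing(f)`, and `Sing(f)` is "the closed subscheme defined by the first Fitting
ideal of the sheaf `Ω_{X/S}`" (2.21). In the split case used by the tree (`A' = A`, the
complete local ring of the base), the statement to prove is: for a local homomorphism of
Noetherian local rings `A → B` essentially of finite type with the same residue field, and a
structure isomorphism `Ψ : B̂ ≅ Â⟦u, v⟧/(uv - h)` under which `A` acts through the constants,
the extension of `Fitt₁(Ω_{B/A}) ⊆ B` to `B̂` is carried by `Ψ` onto the ideal `(u, v)`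
(`DeJong1996.NodeDeformationRing.map_fittingIdeal_eq_span`). Everything is PROVED, there is no
definition and no named fact. The proof avoids the module of continuous differentials of
`Â⟦u, v⟧/(uv - h)` (absent from Mathlib) and runs inside `B`:

* generators: for `u', v' ∈ B` approximating `u, v` modulo `𝔪̂²` one has
  `𝔪_B = (u', v') + 𝔪_A B` (read off `𝔪_{B̂} = Ψ⁻¹(u, v, 𝔪_Â)` by Nakayama in `B̂` and faithful
  flatness of `B → B̂`), hence `Ω_{B/A} = B du' + B dv'` (Nakayama, the residue field of `B`
  being that of `A`; `KaehlerDifferential.span_range_D_eq_top_of_maximalIdeal_eq_span` of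
  `NodeFittingIdeal.lean`);
* `⊆`: by Fitting's lemma `Fitt₁(Ω_{B/A})` is generated by the entries of the relations
  `a du' + b dv' = 0`; the coefficients of `u` and of `v` modulo `(h)`
  (`DeJong1996.NodeDeformationRing.linCoeff` of `NodeLocalStructureAlgebra.lean`) are two
  `A`-derivations `B → Â/(h)` whose matrix of values on `u', v'` is `≡ 1 (mod 𝔪)`, so `a` and `b`
  die in `Â/(h) = (Â⟦u, v⟧/(uv - h))/(u, v)`, i.e. map into `(u, v)`;
* `⊇`: for every `n`, elements `uₙ, vₙ ∈ B` approximating `u, v` and `aₙ ∈ A` approximating `h`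
  modulo `𝔪̂ⁿ⁺¹` give `uₙ vₙ - aₙ ∈ 𝔪_Bⁿ⁺¹`, so `d(uₙ vₙ) = uₙ dvₙ + vₙ duₙ ∈ 𝔪_Bⁿ Ω_{B/A}`
  (`Derivation.apply_mem_pow_smul_top`), a relation whose entries — in `Fitt₁` — are
  `vₙ + …, uₙ + …` up to an invertible matrix and `𝔪ⁿ`; hence `u, v ∈ Fitt₁ B̂ + 𝔪̂ⁿ` for all
  `n`, and Krull's intersection theorem concludes (the approximation technique of
  `NodeFittingIdeal.lean`, Stacks 0C4D).

## Sources

* A. J. de Jong, *Smoothness, semi-stability and alterations*, Publ. Math. IHÉS 83 (1996) 51–93: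
  2.21, 2.23 with its Remark (pp. 61–62). [DeJong1996]
* D. Eisenbud, *Commutative Algebra*, GTM 150 (1995), §16.1, §20.2 (Fitting's lemma, Cor. 20.4).
* The Stacks Project, Tag 0C4D (the approximation argument), Tag 07Z8.
-/

noncomputable section

namespace Literature.AlgebraicGeometry.Resolution

open IsLocalRing Literature.RingTheory.FittingIdeal NodalDeformation

universe u

/-! ## The maximal ideal of `P⟦u, v⟧` and of `P⟦u, v⟧/(uv - h)` over a local ring `P` -/

/-- Over a local ring `P`, the maximal ideal of `P⟦X₀, X₁⟧` is `(X₀, X₁) + 𝔪_P P⟦X₀, X₁⟧`.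
[folklore] -/
theorem maximalIdeal_mvPowerSeries_fin_two_eq_span_sup_map {P : Type u} [CommRing P]
    [IsLocalRing P] :
    maximalIdeal (MvPowerSeries (Fin 2) P) =
      Ideal.span {(MvPowerSeries.X 0 : MvPowerSeries (Fin 2) P), MvPowerSeries.X 1} ⊔
        (maximalIdeal P).map (MvPowerSeries.C : P →+* MvPowerSeries (Fin 2) P) := by
  apply le_antisymm
  · intro φ hφ
    rw [MvPowerSeries.mem_maximalIdeal_iff_constantCoeff_mem] at hφ
    have hsplit : φ = (φ - MvPowerSeries.C (MvPowerSeries.constantCoeff φ)) +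
        MvPowerSeries.C (MvPowerSeries.constantCoeff φ) := by ring
    rw [hsplit]
    refine Ideal.add_mem _ (Ideal.mem_sup_left ?_) (Ideal.mem_sup_right (Ideal.mem_map_of_mem _ hφ))
    refine MvPowerSeries.mem_span_X_pair_of_constantCoeff_eq_zero ?_
    rw [map_sub, MvPowerSeries.constantCoeff_C, sub_self]
  · refine sup_le ?_ ?_
    · rw [Ideal.span_le]
      rintro _ (rfl | rfl) <;>
      · rw [SetLike.mem_coe, MvPowerSeries.mem_maximalIdeal_iff_constantCoeff_mem,
          MvPowerSeries.constantCoeff_X]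
        exact Ideal.zero_mem _
    · rw [Ideal.map_le_iff_le_comap]
      intro a ha
      rw [Ideal.mem_comap, MvPowerSeries.mem_maximalIdeal_iff_constantCoeff_mem,
        MvPowerSeries.constantCoeff_C]
      exact ha

/-- **Krull's intersection theorem, `⋂ₙ (J + 𝔪ⁿ) = J`** in a Noetherian local ring `(R, 𝔪)` (`⋂ₙ 𝔪ⁿ
(R/J) = 0`). This is the tree's `mem_of_forall_mem_sup_pow` (`NodalDeformation.lean`); the
`Ideal.`-dotted name is kept for the use below. [folklore] -/
theorem Ideal.mem_of_forall_mem_sup_maximalIdeal_pow {R : Type u} [CommRing R] [IsLocalRing R]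
    [IsNoetherianRing R] (J : Ideal R) {z : R} (hz : ∀ n : ℕ, z ∈ J ⊔ maximalIdeal R ^ n) :
    z ∈ J :=
  mem_of_forall_mem_sup_pow J hz

namespace DeJong1996.NodeDeformationRing

/-- **The maximal ideal of the model `P⟦u, v⟧/(uv - h)`** (`P` local, `h ∈ 𝔪_P`) is
`(u, v) + 𝔪_P`. [cite: DeJong1996, 2.23, p. 62] -/
theorem maximalIdeal_eq_span_sup_map {P : Type u} [CommRing P] [IsLocalRing P] {h : P}
    (hm : h ∈ maximalIdeal P) :
    letI := NodeDeformationRing.isLocalRing hm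
    maximalIdeal (NodeDeformationRing P h) =
      Ideal.span {Ideal.Quotient.mk _ (MvPowerSeries.X 0),
        Ideal.Quotient.mk _ (MvPowerSeries.X 1)} ⊔ (maximalIdeal P).map (ofBase P h) := by
  letI := NodeDeformationRing.isLocalRing hm
  rw [← DeJong1996.SemiStablePair.map_mk_maximalIdeal_eq (Ideal.span {nodeDeformationRelation P h}),
    maximalIdeal_mvPowerSeries_fin_two_eq_span_sup_map, Ideal.map_sup, Ideal.map_span,
    Set.image_pair, Ideal.map_map]
  rfl

/-- An element of `P⟦u, v⟧/(uv - h)` killed by the evaluation `u = v = 0` modulo `𝔓 ∋ h`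
(`ccBar`) lies in `(u, v) + 𝔓`. [folklore] -/
theorem mem_span_sup_map_of_ccBar_eq_zero {P : Type u} [CommRing P] {h : P} (𝔓 : Ideal P)
    (hh : h ∈ 𝔓) {z : NodeDeformationRing P h} (hz : ccBar 𝔓 hh z = 0) :
    z ∈ Ideal.span {Ideal.Quotient.mk _ (MvPowerSeries.X 0),
      Ideal.Quotient.mk _ (MvPowerSeries.X 1)} ⊔ 𝔓.map (ofBase P h) := by
  obtain ⟨G, rfl⟩ := Ideal.Quotient.mk_surjective z
  rw [ccBar_mk, Ideal.Quotient.eq_zero_iff_mem] at hz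
  have hsplit : G = (G - MvPowerSeries.C (MvPowerSeries.constantCoeff G)) +
      MvPowerSeries.C (MvPowerSeries.constantCoeff G) := by ring
  rw [hsplit, map_add]
  refine Ideal.add_mem _ (Ideal.mem_sup_left ?_) (Ideal.mem_sup_right ?_)
  · have hG : G - MvPowerSeries.C (MvPowerSeries.constantCoeff G) ∈
        Ideal.span {(MvPowerSeries.X 0 : MvPowerSeries (Fin 2) P), MvPowerSeries.X 1} := by
      refine MvPowerSeries.mem_span_X_pair_of_constantCoeff_eq_zero ?_
      rw [map_sub, MvPowerSeries.constantCoeff_C, sub_self]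
    have h2 :=
      Ideal.mem_map_of_mem (Ideal.Quotient.mk (Ideal.span {nodeDeformationRelation P h})) hG
    rwa [Ideal.map_span, Set.image_pair] at h2
  · exact Ideal.mem_map_of_mem (ofBase P h) hz

/-- For `𝔓 = (h)`: an element killed by `ccBar` lies in `(u, v)` (as `h = uv` there).
[folklore] -/
theorem mem_span_of_ccBar_eq_zero {P : Type u} [CommRing P] {h : P}
    {z : NodeDeformationRing P h}
    (hz : ccBar (Ideal.span {h}) (Ideal.subset_span rfl) z = 0) :
    z ∈ Ideal.span
      {Ideal.Quotient.mk (Ideal.span {nodeDeformationRelation P h}) (MvPowerSeries.X 0),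
        Ideal.Quotient.mk _ (MvPowerSeries.X 1)} := by
  have h1 := mem_span_sup_map_of_ccBar_eq_zero (Ideal.span {h}) (Ideal.subset_span rfl) hz
  have hle : (Ideal.span {h}).map (ofBase P h) ≤
      Ideal.span {Ideal.Quotient.mk (Ideal.span {nodeDeformationRelation P h}) (MvPowerSeries.X 0),
        Ideal.Quotient.mk _ (MvPowerSeries.X 1)} := by
    rw [Ideal.map_span, Set.image_singleton, Ideal.span_singleton_le_iff_mem, ← mk_X_mul_mk_X]
    exact Ideal.mul_mem_left _ _ (Ideal.subset_span (Or.inr rfl))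
  exact (sup_le le_rfl hle) h1

/-- A structure isomorphism `B̂ ≅ P⟦u, v⟧/(uv - h)` with `B` local forces `h ∈ 𝔪_P`: otherwise
`uv - h` is a unit and the model is the zero ring. [folklore] -/
theorem mem_maximalIdeal_of_ringEquiv {S P : Type u} [CommRing S] [Nontrivial S] [CommRing P]
    [IsLocalRing P] {h : P} (Ψ : S ≃+* NodeDeformationRing P h) : h ∈ maximalIdeal P := by
  by_contra hu
  rw [mem_maximalIdeal, mem_nonunits_iff, not_not] at hu
  have hrel : IsUnit (nodeDeformationRelation P h) := by
    rw [MvPowerSeries.isUnit_iff_constantCoeff, constantCoeff_nodeDeformationRelation]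
    exact hu.neg
  have htop : Ideal.span {nodeDeformationRelation P h} = ⊤ := Ideal.span_singleton_eq_top.mpr hrel
  haveI : Subsingleton (NodeDeformationRing P h) := Ideal.Quotient.subsingleton_iff.mpr htop
  exact not_subsingleton S Ψ.toEquiv.subsingleton

/-! ## The Remark of 2.23 -/

section Trace

variable {A B : Type u} [CommRing A] [CommRing B] [IsLocalRing A] [IsNoetherianRing A]
  [IsLocalRing B] [IsNoetherianRing B] [Algebra A B]

set_option maxHeartbeats 400000 in
/-- **de Jong 1996, 2.23, Remark: "the trace of `Sing(f)` on the scheme `Spec B` is given by the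
ideal `(u, v) ⊂ B`."** Let `A → B` be a local homomorphism of Noetherian local rings,
essentially of finite type, inducing an isomorphism on residue fields in the form "every
`b ∈ B` is `a + x` with `a ∈ A`, `x ∈ 𝔪_B`", and let `Ψ : B̂ ≅ Â⟦u, v⟧/(uv - h)` be a ring
isomorphism under which `A` acts through the constants. Then `Ψ` carries the extension
`Fitt₁(Ω_{B/A}) B̂` of the first Fitting ideal of `Ω_{B/A}` (the stalk of the ideal of
`Sing(f)`, 2.21) onto the ideal `(u, v)`. See the module docstring for the proof.
[cite: DeJong1996, 2.23 Remark, p. 62] -/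
theorem map_fittingIdeal_eq_span [IsLocalHom (algebraMap A B)] [Algebra.EssFiniteType A B]
    (hres : ∀ b : B, ∃ a : A, b - algebraMap A B a ∈ maximalIdeal B)
    {h : Cpl A} (Ψ : Cpl B ≃+* NodeDeformationRing (Cpl A) h)
    (hΨ : ∀ a : A, Ψ (algebraMap B (Cpl B) (algebraMap A B a)) =
      Ideal.Quotient.mk _ (MvPowerSeries.C (algebraMap A (Cpl A) a))) :
    ((Module.fittingIdeal B Ω[B⁄A] 1).map (algebraMap B (Cpl B))).map Ψ.toRingHom =
      Ideal.span {Ideal.Quotient.mk _ (MvPowerSeries.X 0),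
        Ideal.Quotient.mk _ (MvPowerSeries.X 1)} := by
  classical
  set M : Type u := NodeDeformationRing (Cpl A) h with hM
  -- ### notation and instances
  have hm : h ∈ maximalIdeal (Cpl A) := mem_maximalIdeal_of_ringEquiv Ψ
  haveI hMloc : IsLocalRing M := NodeDeformationRing.isLocalRing hm
  haveI : IsNoetherianRing (Cpl B) := isNoetherianRing_adicCompletion_maximalIdeal B
  haveI : IsNoetherianRing M := isNoetherianRing_of_ringEquiv (Cpl B) Ψ
  set θ : B →+* M := Ψ.toRingHom.comp (algebraMap B (Cpl B)) with hθ
  have hθapply : ∀ b, θ b = Ψ (algebraMap B (Cpl B) b) := fun _ => rfl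
  have hθA : ∀ a : A, θ (algebraMap A B a) = ofBase (Cpl A) h (algebraMap A (Cpl A) a) := hΨ
  set uM : M := Ideal.Quotient.mk (Ideal.span {nodeDeformationRelation (Cpl A) h})
    (MvPowerSeries.X 0) with huM
  set vM : M := Ideal.Quotient.mk (Ideal.span {nodeDeformationRelation (Cpl A) h})
    (MvPowerSeries.X 1) with hvM
  set I : Ideal B := Module.fittingIdeal B Ω[B⁄A] 1 with hI
  -- the statement in terms of `θ`
  rw [Ideal.map_map]
  change I.map θ = Ideal.span {uM, vM}
  -- ### powers of the maximal ideals along `θ`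
  have hmapΨ : ∀ J : Ideal (Cpl B), J.map Ψ.toRingHom = J.map Ψ := fun _ => rfl
  have hpowM : ∀ k : ℕ, (maximalIdeal B ^ k).map θ = maximalIdeal M ^ k := fun k => by
    rw [hθ, ← Ideal.map_map, Ideal.map_pow, ← AdicCompletion.maximalIdeal_eq_map, hmapΨ,
      Ideal.map_pow, map_ringEquiv_maximalIdeal Ψ]
  have hθmem : ∀ (k : ℕ) (b : B), θ b ∈ maximalIdeal M ^ k ↔ b ∈ maximalIdeal B ^ k := by
    intro k b
    rw [← AdicCompletion.algebraMap_mem_map_pow_maximalIdeal_iff (B := B) k b, ← hpowM k, hθ,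
      ← Ideal.map_map, hmapΨ]
    constructor
    · intro hb
      have h1 : algebraMap B (Cpl B) b ∈
          (((maximalIdeal B ^ k).map (algebraMap B (Cpl B))).map Ψ).comap Ψ :=
        Ideal.mem_comap.mpr hb
      rwa [Ideal.comap_map_of_bijective Ψ Ψ.bijective] at h1
    · intro hb
      exact Ideal.mem_map_of_mem Ψ hb
  have hθmem1 : ∀ b : B, θ b ∈ maximalIdeal M ↔ b ∈ maximalIdeal B := fun b => by
    simpa only [pow_one] using hθmem 1 b
  -- ### approximations in `B` of `u`, `v` modulo `𝔪̂ᵏ`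
  have happrox : ∀ (k : ℕ) (z : M), ∃ b : B, ∃ d ∈ maximalIdeal M ^ k, θ b = z - d := by
    intro k z
    obtain ⟨b, hb⟩ := exists_sub_algebraMap_mem_pow (A := B) (Ψ.symm z) k
    refine ⟨b, Ψ (Ψ.symm z - algebraMap B (Cpl B) b), ?_, ?_⟩
    · have hmap : (maximalIdeal (Cpl B) ^ k).map Ψ = maximalIdeal M ^ k := by
        rw [Ideal.map_pow, map_ringEquiv_maximalIdeal Ψ]
      rw [← hmap]
      exact Ideal.mem_map_of_mem Ψ hb
    · rw [map_sub, RingEquiv.apply_symm_apply, sub_sub_cancel, hθapply]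
  -- approximation in `A` of `h`
  have happroxA : ∀ k : ℕ, ∃ a : A, ∃ d ∈ maximalIdeal M ^ k,
      θ (algebraMap A B a) = ofBase (Cpl A) h h - d := by
    intro k
    obtain ⟨a, ha⟩ := exists_sub_algebraMap_mem_pow (A := A) h k
    refine ⟨a, ofBase (Cpl A) h (h - algebraMap A (Cpl A) a), ?_, ?_⟩
    · have hle : (maximalIdeal (Cpl A) ^ k).map (ofBase (Cpl A) h) ≤ maximalIdeal M ^ k := by
        rw [Ideal.map_pow]
        refine Ideal.pow_right_mono ?_ k
        rw [maximalIdeal_eq_span_sup_map hm]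
        exact le_sup_right
      exact hle (Ideal.mem_map_of_mem _ ha)
    · rw [hθA, map_sub, sub_sub_cancel]
  -- ### the generators `u', v'` (`n = 2`)
  obtain ⟨u', d₀, hd₀, hu'⟩ := happrox 2 uM
  obtain ⟨v', d₁, hd₁, hv'⟩ := happrox 2 vM
  have huMmem : uM ∈ maximalIdeal M := by
    rw [maximalIdeal_eq_span_sup_map hm]
    exact Ideal.mem_sup_left (Ideal.subset_span (Or.inl rfl))
  have hvMmem : vM ∈ maximalIdeal M := by
    rw [maximalIdeal_eq_span_sup_map hm]
    exact Ideal.mem_sup_left (Ideal.subset_span (Or.inr rfl))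
  have hsq_le : maximalIdeal M ^ 2 ≤ maximalIdeal M := Ideal.pow_le_self two_ne_zero
  have hu'mem : u' ∈ maximalIdeal B := by
    rw [← hθmem1, hu']
    exact Ideal.sub_mem _ huMmem (hsq_le hd₀)
  have hv'mem : v' ∈ maximalIdeal B := by
    rw [← hθmem1, hv']
    exact Ideal.sub_mem _ hvMmem (hsq_le hd₁)
  -- ### `𝔪_B = (u', v') + 𝔪_A B`
  set J : Ideal B := Ideal.span {u', v'} ⊔ (maximalIdeal A).map (algebraMap A B) with hJ
  have hJle : J ≤ maximalIdeal B := by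
    refine sup_le ?_ (map_maximalIdeal_le _)
    rw [Ideal.span_le]
    rintro w (rfl | rfl)
    · exact hu'mem
    · exact hv'mem
  have hmapA : (maximalIdeal (Cpl A)).map (ofBase (Cpl A) h) =
      ((maximalIdeal A).map (algebraMap A B)).map θ := by
    rw [AdicCompletion.maximalIdeal_eq_map, Ideal.map_map, Ideal.map_map]
    congr 1
    exact RingHom.ext fun a => (hθA a).symm
  have hJθ : J.map θ = maximalIdeal M := by
    apply le_antisymm
    · calc J.map θ ≤ (maximalIdeal B).map θ := Ideal.map_mono hJle
        _ = maximalIdeal M := by simpa only [pow_one] using hpowM 1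
    · -- Nakayama in `M = Â⟦u, v⟧/(uv - h)`: `𝔪_M ⊆ θ(J) M + 𝔪_M²`
      refine Submodule.le_of_le_smul_of_le_jacobson_bot (IsNoetherian.noetherian _)
        (maximalIdeal_le_jacobson _) ?_
      rw [Ideal.smul_eq_mul, ← pow_two]
      nth_rw 1 [maximalIdeal_eq_span_sup_map hm]
      refine sup_le ?_ ?_
      · rw [Ideal.span_le]
        rintro w (rfl | rfl)
        · have e1 : uM = θ u' + d₀ := by rw [hu', sub_add_cancel]
          rw [SetLike.mem_coe, ← huM, e1]
          exact Submodule.add_mem _ (Submodule.mem_sup_left (Ideal.mem_map_of_mem θ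
            (Ideal.mem_sup_left (Ideal.subset_span (Or.inl rfl)))))
            (Submodule.mem_sup_right hd₀)
        · have e1 : vM = θ v' + d₁ := by rw [hv', sub_add_cancel]
          rw [SetLike.mem_coe, ← hvM, e1]
          exact Submodule.add_mem _ (Submodule.mem_sup_left (Ideal.mem_map_of_mem θ
            (Ideal.mem_sup_left (Ideal.subset_span (Or.inr rfl)))))
            (Submodule.mem_sup_right hd₁)
      · rw [hmapA]
        exact le_sup_of_le_left (Ideal.map_mono le_sup_right)
  have hJeq : J = maximalIdeal B := by
    haveI : Module.FaithfullyFlat B (Cpl B) := Module.FaithfullyFlat.of_flat_of_isLocalHom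
    have h1 : (J.map (algebraMap B (Cpl B))).map Ψ =
        ((maximalIdeal B).map (algebraMap B (Cpl B))).map Ψ := by
      rw [← hmapΨ, ← hmapΨ, Ideal.map_map, Ideal.map_map, ← hθ, hJθ]
      simpa only [pow_one] using (hpowM 1).symm
    have h2 : J.map (algebraMap B (Cpl B)) = (maximalIdeal B).map (algebraMap B (Cpl B)) := by
      have := congrArg (Ideal.comap Ψ) h1
      rwa [Ideal.comap_map_of_bijective Ψ Ψ.bijective,
        Ideal.comap_map_of_bijective Ψ Ψ.bijective] at this
    exact Ideal.map_injective_of_faithfullyFlat (A := B) (B := Cpl B) h2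
  -- ### `Ω_{B/A} = B du' + B dv'`
  haveI : Module.Finite B Ω[B⁄A] := inferInstance
  let g : Fin 2 ⊕ (maximalIdeal A) → B := Sum.elim ![u', v'] fun a => algebraMap A B a
  have hg : maximalIdeal B = Ideal.span (Set.range g) := by
    rw [← hJeq, hJ, Set.Sum.elim_range, Ideal.span_union, Set.range_vecCons_vecCons_eq_pair]
    congr 1
    rw [Ideal.map]
    congr 1
    ext b
    constructor
    · rintro ⟨a, ha, rfl⟩
      exact ⟨⟨a, ha⟩, rfl⟩
    · rintro ⟨⟨a, ha⟩, rfl⟩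
      exact ⟨a, ha, rfl⟩
  have hspan_all :=
    KaehlerDifferential.span_range_D_eq_top_of_maximalIdeal_eq_span (K := A) hres g hg
  let x : Fin (1 + 1) → Ω[B⁄A] := ![KaehlerDifferential.D A B u', KaehlerDifferential.D A B v']
  have hx : Submodule.span B (Set.range x) = ⊤ := by
    apply top_le_iff.mp
    rw [← hspan_all, Submodule.span_le]
    rintro _ ⟨i, rfl⟩
    rcases i with i | a
    · refine Submodule.subset_span ⟨i, ?_⟩
      fin_cases i <;> rfl
    · simp only [g, Sum.elim_inr, Derivation.map_algebraMap, SetLike.mem_coe]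
      exact Submodule.zero_mem _
  have hx0 : x 0 = KaehlerDifferential.D A B u' := rfl
  have hx1 : x 1 = KaehlerDifferential.D A B v' := rfl
  -- ### the two derivations `∂/∂u`, `∂/∂v` modulo `(h)`, with values in `N = Â/(h)`
  set 𝔓 : Ideal (Cpl A) := Ideal.span {h} with h𝔓
  have hh : h ∈ 𝔓 := Ideal.subset_span rfl
  set N : Type u := (Cpl A) ⧸ 𝔓 with hN
  have h𝔓top : 𝔓 ≠ ⊤ := fun htop =>
    (maximalIdeal.isMaximal (Cpl A)).ne_top
      (top_le_iff.mp (htop ▸ (Ideal.span_singleton_le_iff_mem _).mpr hm))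
  haveI : Nontrivial N := Ideal.Quotient.nontrivial_iff.mpr h𝔓top
  haveI : IsLocalRing N :=
    IsLocalRing.of_surjective' (Ideal.Quotient.mk 𝔓) Ideal.Quotient.mk_surjective
  set χ : B →+* N := (ccBar 𝔓 hh).comp θ with hχ
  have hχθ : ∀ b, χ b = ccBar 𝔓 hh (θ b) := fun _ => rfl
  letI algBN : Algebra B N := χ.toAlgebra
  have hAN : ∀ a : A, algebraMap A N a = χ (algebraMap A B a) := fun a => by
    rw [hχθ, hθA, ofBase_apply, ccBar_mk, MvPowerSeries.constantCoeff_C]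
    rfl
  haveI : IsScalarTower A B N := IsScalarTower.of_algebraMap_eq hAN
  have hlin : ∀ (j : Fin 2) (a : A) (b : B),
      linCoeff 𝔓 j (θ (a • b)) = a • linCoeff 𝔓 j (θ b) := by
    intro j a b
    rw [Algebra.smul_def, map_mul, linCoeff_mul 𝔓 hh, hθA a, ofBase_apply, linCoeff_mk_C 𝔓 hh,
      zero_mul, add_zero, Algebra.smul_def, hAN, hχθ, hθA, ofBase_apply]
  let Dlin : Fin 2 → (B →ₗ[A] N) := fun j =>
    { toFun := fun b => linCoeff 𝔓 j (θ b)
      map_add' := fun b c => by simp only [map_add, linCoeff_add 𝔓 hh]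
      map_smul' := fun a b => hlin j a b }
  have hDlin : ∀ j b, Dlin j b = linCoeff 𝔓 j (θ b) := fun _ _ => rfl
  let D : Fin 2 → Derivation A B N := fun j =>
    Derivation.mk' (Dlin j) (fun b c => by
      rw [hDlin, hDlin, hDlin, map_mul, linCoeff_mul 𝔓 hh, Algebra.smul_def, Algebra.smul_def]
      change _ = χ b * _ + χ c * _
      rw [hχθ, hχθ]
      ring)
  have hD : ∀ j b, D j b = linCoeff 𝔓 j (θ b) := fun _ _ => rfl
  -- their values on `u', v'`: a matrix `≡ 1 (mod 𝔪_N)`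
  set 𝔪' : Ideal N := (maximalIdeal (Cpl A)).map (Ideal.Quotient.mk 𝔓) with h𝔪'
  have h𝔪'le : 𝔪' ≤ maximalIdeal N := by
    haveI : IsLocalHom (Ideal.Quotient.mk 𝔓) :=
      IsLocalHom.of_surjective _ Ideal.Quotient.mk_surjective
    exact map_maximalIdeal_le _
  have hval : ∀ i j : Fin 2, ∀ {b : B} {d : M}, d ∈ maximalIdeal M ^ 2 →
      θ b = Ideal.Quotient.mk _ (MvPowerSeries.X j) - d →
      ∃ m ∈ maximalIdeal N, D i b = (if j = i then 1 else 0) - m := by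
    intro i j b d hd hb
    refine ⟨linCoeff 𝔓 i d, h𝔪'le (linCoeff_mem_of_mem_sq 𝔓 hh hm i hd), ?_⟩
    rw [hD, hb, linCoeff_sub 𝔓 hh, linCoeff_mk_X 𝔓 hh]
  obtain ⟨m₀₀, hm₀₀, h₀₀⟩ := hval 0 0 hd₀ hu'
  obtain ⟨m₁₀, hm₁₀, h₁₀⟩ := hval 1 0 hd₀ hu'
  obtain ⟨m₀₁, hm₀₁, h₀₁⟩ := hval 0 1 hd₁ hv'
  obtain ⟨m₁₁, hm₁₁, h₁₁⟩ := hval 1 1 hd₁ hv'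
  simp only [if_true, show ((0 : Fin 2) = 1) = False from by decide,
    show ((1 : Fin 2) = 0) = False from by decide, if_false] at h₀₀ h₁₀ h₀₁ h₁₁
  -- a unit criterion in the local rings `N` and `M`
  have hunitN : ∀ {t : N}, 1 - t ∈ maximalIdeal N → IsUnit t := by
    intro t ht
    by_contra hu
    have h1 : (1 : N) ∈ maximalIdeal N := by
      have := Ideal.add_mem _ ht ((mem_maximalIdeal _).mpr (mem_nonunits_iff.mpr hu))
      rwa [sub_add_cancel] at this
    exact (maximalIdeal.isMaximal N).ne_top (Ideal.eq_top_of_isUnit_mem _ h1 isUnit_one)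
  have hunitM : ∀ {t : M}, 1 - t ∈ maximalIdeal M → IsUnit t := by
    intro t ht
    by_contra hu
    have h1 : (1 : M) ∈ maximalIdeal M := by
      have := Ideal.add_mem _ ht ((mem_maximalIdeal _).mpr (mem_nonunits_iff.mpr hu))
      rwa [sub_add_cancel] at this
    exact (maximalIdeal.isMaximal M).ne_top (Ideal.eq_top_of_isUnit_mem _ h1 isUnit_one)
  -- ### `⊆`: `Fitt₁ ⊆ ker χ`, by Fitting's lemma on the generators `du', dv'`
  have hupper : I ≤ RingHom.ker χ := by
    rw [hI, Module.fittingIdeal_eq_relMinorIdeal x hx 1, show (1 + 1 - 1 : ℕ) = 1 from rfl,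
      Module.relMinorIdeal_le_iff]
    intro ρ σ hρ
    -- the relation `ρ₀₀ du' + ρ₀₁ dv' = 0` read through `D 0`, `D 1`
    have hrel :
        ρ 0 0 • KaehlerDifferential.D A B u' + ρ 0 1 • KaehlerDifferential.D A B v' = 0 := by
      have := hρ 0
      rwa [Fin.sum_univ_two] at this
    have heval : ∀ j : Fin 2, χ (ρ 0 0) * D j u' + χ (ρ 0 1) * D j v' = 0 := by
      intro j
      have h1 := congrArg ((D j).liftKaehlerDifferential) hrel
      rw [map_add, map_smul, map_smul, map_zero, Derivation.liftKaehlerDifferential_comp_D,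
        Derivation.liftKaehlerDifferential_comp_D, Algebra.smul_def, Algebra.smul_def] at h1
      exact h1
    have e0 := heval 0
    have e1 := heval 1
    rw [h₀₀, h₀₁] at e0
    rw [h₁₀, h₁₁] at e1
    -- the determinant `(1 - m₀₀)(1 - m₁₁) - m₀₁ m₁₀` is a unit
    have hdet : IsUnit ((1 - m₀₀) * (1 - m₁₁) - m₀₁ * m₁₀) := by
      refine hunitN ?_
      have e : 1 - ((1 - m₀₀) * (1 - m₁₁) - m₀₁ * m₁₀) =
          m₀₀ + m₁₁ - m₀₀ * m₁₁ + m₀₁ * m₁₀ := by ring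
      rw [e]
      exact Ideal.add_mem _ (Ideal.sub_mem _ (Ideal.add_mem _ hm₀₀ hm₁₁)
        (Ideal.mul_mem_left _ _ hm₁₁)) (Ideal.mul_mem_left _ _ hm₁₀)
    have ha : χ (ρ 0 0) = 0 := by
      have h2 : χ (ρ 0 0) * ((1 - m₀₀) * (1 - m₁₁) - m₀₁ * m₁₀) = 0 := by
        linear_combination (1 - m₁₁) * e0 + m₀₁ * e1
      exact (hdet.mul_left_eq_zero).mp h2
    have hb : χ (ρ 0 1) = 0 := by
      have h2 : χ (ρ 0 1) * ((1 - m₀₀) * (1 - m₁₁) - m₀₁ * m₁₀) = 0 := by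
        linear_combination m₁₀ * e0 + (1 - m₀₀) * e1
      exact (hdet.mul_left_eq_zero).mp h2
    have hall : ∀ l : Fin (1 + 1), ρ 0 l ∈ RingHom.ker χ := by
      intro l
      fin_cases l
      · exact ha
      · exact hb
    rw [Matrix.det_unique]
    exact hall _
  have hupper' : I.map θ ≤ Ideal.span {uM, vM} := by
    rw [Ideal.map_le_iff_le_comap]
    intro i hi
    rw [Ideal.mem_comap]
    exact mem_span_of_ccBar_eq_zero (hupper hi)
  -- ### `⊇`: `u, v ∈ θ(Fitt₁) M + 𝔪_Mⁿ` for every `n`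
  have hDsmul : ∀ {k : ℕ} {w : B}, w ∈ maximalIdeal B ^ (k + 1) →
      ∃ c₀ ∈ maximalIdeal B ^ k, ∃ c₁ ∈ maximalIdeal B ^ k,
        KaehlerDifferential.D A B w =
          c₀ • KaehlerDifferential.D A B u' + c₁ • KaehlerDifferential.D A B v' := by
    intro k w hw
    have hd :
        KaehlerDifferential.D A B w ∈ maximalIdeal B ^ k • Submodule.span B (Set.range x) := by
      rw [hx]
      exact Derivation.apply_mem_pow_smul_top _ _ k hw
    obtain ⟨c, hc, hsum⟩ :=
      (Submodule.mem_ideal_smul_span_iff_exists_sum (maximalIdeal B ^ k) x _).mp hd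
    refine ⟨c 0, hc 0, c 1, hc 1, ?_⟩
    rw [← hsum, Finsupp.sum_fintype _ _ (fun i => zero_smul B (x i)), Fin.sum_univ_two, hx0, hx1]
  have key : ∀ n : ℕ, uM ∈ I.map θ ⊔ maximalIdeal M ^ n ∧ vM ∈ I.map θ ⊔ maximalIdeal M ^ n := by
    intro n
    rcases Nat.eq_zero_or_pos n with rfl | hn
    · rw [pow_zero, Ideal.one_eq_top]
      exact ⟨Submodule.mem_sup_right Submodule.mem_top, Submodule.mem_sup_right Submodule.mem_top⟩
    set J' : Ideal M := I.map θ ⊔ maximalIdeal M ^ n with hJ'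
    -- approximations modulo `𝔪̂ⁿ⁺¹`
    obtain ⟨un, p, hp, hun⟩ := happrox (n + 1) uM
    obtain ⟨vn, q, hq, hvn⟩ := happrox (n + 1) vM
    obtain ⟨an, s, hs, han⟩ := happroxA (n + 1)
    have hpow_le : maximalIdeal M ^ (n + 1) ≤ maximalIdeal M ^ n :=
      Ideal.pow_le_pow_right (by omega)
    have hpow_le2 : maximalIdeal M ^ (n + 1) ≤ maximalIdeal M ^ 2 :=
      Ideal.pow_le_pow_right (by omega)
    have hpow_le1 : maximalIdeal M ^ n ≤ maximalIdeal M := Ideal.pow_le_self (by omega)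
    -- `r = uₙ vₙ - aₙ ∈ 𝔪_Bⁿ⁺¹`
    set r : B := un * vn - algebraMap A B an with hr
    have hθr : θ r ∈ maximalIdeal M ^ (n + 1) := by
      have e : θ r = -(uM * q) - p * vM + p * q + s + (uM * vM - ofBase (Cpl A) h h) := by
        rw [hr, map_sub, map_mul, hun, hvn, han]; ring
      rw [e, huM, hvM, mk_X_mul_mk_X, sub_self, add_zero]
      refine Ideal.add_mem _ (Ideal.add_mem _ (Ideal.sub_mem _ (Submodule.neg_mem _
        (Ideal.mul_mem_left _ _ hq)) (Ideal.mul_mem_right _ _ hp)) (Ideal.mul_mem_left _ _ hq)) hs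
    have hrmem : r ∈ maximalIdeal B ^ (n + 1) := (hθmem _ _).mp hθr
    -- `d r = uₙ dvₙ + vₙ duₙ ∈ 𝔪ⁿ Ω`
    obtain ⟨α, hα, β, hβ, hαβ⟩ := hDsmul hrmem
    have hdr : KaehlerDifferential.D A B r =
        un • KaehlerDifferential.D A B vn + vn • KaehlerDifferential.D A B un := by
      rw [hr, map_sub, Derivation.leibniz, Derivation.map_algebraMap, sub_zero]
    -- `duₙ`, `dvₙ` in terms of `du'`, `dv'`
    have hwu : un - u' ∈ maximalIdeal B ^ (1 + 1) := by
      rw [← hθmem, map_sub, hun, hu']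
      have e : uM - p - (uM - d₀) = d₀ - p := by ring
      rw [e]
      exact Ideal.sub_mem _ hd₀ (hpow_le2 hp)
    have hwv : vn - v' ∈ maximalIdeal B ^ (1 + 1) := by
      rw [← hθmem, map_sub, hvn, hv']
      have e : vM - q - (vM - d₁) = d₁ - q := by ring
      rw [e]
      exact Ideal.sub_mem _ hd₁ (hpow_le2 hq)
    obtain ⟨μ, hμ, μ', hμ', hdwu⟩ := hDsmul hwu
    obtain ⟨ν, hν, ν', hν', hdwv⟩ := hDsmul hwv
    rw [pow_one] at hμ hμ' hν hν'
    have hdun : KaehlerDifferential.D A B un =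
        (1 + μ) • KaehlerDifferential.D A B u' + μ' • KaehlerDifferential.D A B v' := by
      have e : un = u' + (un - u') := by ring
      rw [e, map_add, hdwu]
      module
    have hdvn : KaehlerDifferential.D A B vn =
        ν • KaehlerDifferential.D A B u' + (1 + ν') • KaehlerDifferential.D A B v' := by
      have e : vn = v' + (vn - v') := by ring
      rw [e, map_add, hdwv]
      module
    -- the relation `E₀ du' + E₁ dv' = 0`
    set E₀ : B := un * ν + vn * (1 + μ) - α with hE₀
    set E₁ : B := un * (1 + ν') + vn * μ' - β with hE₁
    have hrelE : E₀ • KaehlerDifferential.D A B u' + E₁ • KaehlerDifferential.D A B v' = 0 := by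
      have h1 : un • KaehlerDifferential.D A B vn + vn • KaehlerDifferential.D A B un -
          (α • KaehlerDifferential.D A B u' + β • KaehlerDifferential.D A B v') = 0 := by
        rw [← hdr, hαβ, sub_self]
      rw [hdun, hdvn] at h1
      rw [← h1, hE₀, hE₁]
      module
    let ρ : Fin 1 → Fin (1 + 1) → B := fun _ => ![E₀, E₁]
    have hρ : ∀ i, ∑ l, ρ i l • x l = 0 := by
      intro i
      rw [Fin.sum_univ_two]
      exact hrelE
    have hEmem : ∀ l : Fin (1 + 1), ρ 0 l ∈ I := by
      intro l
      have := Module.det_mem_fittingIdeal x hx ρ hρ ⟨fun _ => l, fun i j _ => Subsingleton.elim i j⟩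
      rwa [Matrix.det_unique] at this
    have hE₀mem : θ E₀ ∈ I.map θ := Ideal.mem_map_of_mem θ (hEmem 0)
    have hE₁mem : θ E₁ ∈ I.map θ := Ideal.mem_map_of_mem θ (hEmem 1)
    -- read in `M`: `θν u + (1 + θμ) v ∈ J'` and `(1 + θν') u + θμ' v ∈ J'`
    have hθα : θ α ∈ maximalIdeal M ^ n := (hθmem _ _).mpr hα
    have hθβ : θ β ∈ maximalIdeal M ^ n := (hθmem _ _).mpr hβ
    have he₁ : θ ν * uM + (1 + θ μ) * vM ∈ J' := by
      have e : θ ν * uM + (1 + θ μ) * vM = θ E₀ + (p * θ ν + q * (1 + θ μ) + θ α) := by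
        rw [hE₀, map_sub, map_add, map_mul, map_mul, map_add, map_one, hun, hvn]; ring
      rw [e]
      refine Submodule.add_mem _ (Submodule.mem_sup_left hE₀mem) (Submodule.mem_sup_right ?_)
      exact Ideal.add_mem _ (Ideal.add_mem _ (Ideal.mul_mem_right _ _ (hpow_le hp))
        (Ideal.mul_mem_right _ _ (hpow_le hq))) hθα
    have he₂ : (1 + θ ν') * uM + θ μ' * vM ∈ J' := by
      have e : (1 + θ ν') * uM + θ μ' * vM = θ E₁ + (p * (1 + θ ν') + q * θ μ' + θ β) := by
        rw [hE₁, map_sub, map_add, map_mul, map_mul, map_add, map_one, hun, hvn]; ring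
      rw [e]
      refine Submodule.add_mem _ (Submodule.mem_sup_left hE₁mem) (Submodule.mem_sup_right ?_)
      exact Ideal.add_mem _ (Ideal.add_mem _ (Ideal.mul_mem_right _ _ (hpow_le hp))
        (Ideal.mul_mem_right _ _ (hpow_le hq))) hθβ
    -- the matrix `((θν, 1 + θμ), (1 + θν', θμ'))` has unit determinant
    have hθμ : θ μ ∈ maximalIdeal M := (hθmem1 μ).mpr hμ
    have hθμ' : θ μ' ∈ maximalIdeal M := (hθmem1 μ').mpr hμ'
    have hθν : θ ν ∈ maximalIdeal M := (hθmem1 ν).mpr hν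
    have hθν' : θ ν' ∈ maximalIdeal M := (hθmem1 ν').mpr hν'
    have hΔ : IsUnit ((1 + θ μ) * (1 + θ ν') - θ ν * θ μ') := by
      refine hunitM ?_
      have e : 1 - ((1 + θ μ) * (1 + θ ν') - θ ν * θ μ') =
          -(θ μ + θ ν' + θ μ * θ ν') + θ ν * θ μ' := by ring
      rw [e]
      exact Ideal.add_mem _ (Submodule.neg_mem _ (Ideal.add_mem _ (Ideal.add_mem _ hθμ hθν')
        (Ideal.mul_mem_left _ _ hθν'))) (Ideal.mul_mem_left _ _ hθμ')
    obtain ⟨Δi, hΔi⟩ := hΔ.exists_left_inv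
    have huMJ : uM ∈ J' := by
      have e : uM = Δi * ((1 + θ μ) * ((1 + θ ν') * uM + θ μ' * vM) -
          θ μ' * (θ ν * uM + (1 + θ μ) * vM)) := by
        have : (1 + θ μ) * ((1 + θ ν') * uM + θ μ' * vM) - θ μ' * (θ ν * uM + (1 + θ μ) * vM) =
            ((1 + θ μ) * (1 + θ ν') - θ ν * θ μ') * uM := by ring
        rw [this, ← mul_assoc, hΔi, one_mul]
      rw [e]
      exact Ideal.mul_mem_left _ _ (Ideal.sub_mem _ (Ideal.mul_mem_left _ _ he₂)
        (Ideal.mul_mem_left _ _ he₁))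
    have hvMJ : vM ∈ J' := by
      have e : vM = Δi * ((1 + θ ν') * (θ ν * uM + (1 + θ μ) * vM) -
          θ ν * ((1 + θ ν') * uM + θ μ' * vM)) := by
        have : (1 + θ ν') * (θ ν * uM + (1 + θ μ) * vM) - θ ν * ((1 + θ ν') * uM + θ μ' * vM) =
            ((1 + θ μ) * (1 + θ ν') - θ ν * θ μ') * vM := by ring
        rw [this, ← mul_assoc, hΔi, one_mul]
      rw [e]
      exact Ideal.mul_mem_left _ _ (Ideal.sub_mem _ (Ideal.mul_mem_left _ _ he₁)
        (Ideal.mul_mem_left _ _ he₂))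
    exact ⟨huMJ, hvMJ⟩
  -- Krull's intersection theorem in `M / θ(Fitt₁) M`
  have hkrull : ∀ {z : M},
      (∀ n : ℕ, z ∈ I.map θ ⊔ maximalIdeal M ^ n) → z ∈ I.map θ :=
    fun hz => Ideal.mem_of_forall_mem_sup_maximalIdeal_pow (I.map θ) hz
  -- ### conclusion
  refine le_antisymm hupper' ?_
  rw [Ideal.span_le]
  rintro w (rfl | rfl)
  · exact hkrull fun n => (key n).1
  · exact hkrull fun n => (key n).2

end Trace

end DeJong1996.NodeDeformationRing

end Literature.AlgebraicGeometry.Resolution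

end
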